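import Mathlib
import Summits.ValiantsHypothesis.ValiantsHypothesis.Theorems.KPlusLogSqLawLiftingLaguerreWindowCalculus

/-!
# Sign variations of real sequences: tail sums, partial sums, reversal (variation-diminishing lemmas)

HONEST FRAMING.  Helper file toward the lifting crux `WeakLifting` (stmt-ValiantsHypothesis-19561; aside `Lifting`
stmt-ValiantsHypothesis-19772, registered stub `stub_liftThin`) of route `KPlusLogSqLaw` (cell `pub-symmetroid`, seat
val-sym-lift-p1 g8, 2026-08-27).  Elementary facts about ONE real polynomial / real sequences; nothing here asserts `WeakLifting`,
`TropicalB`, Conjecture B, `MatrixDescartes` (stmt-ValiantsHypothesis-18050) or anything about VP ≠ VNP.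

CONTENT (the Literature's `signVar` on real lists, zeros dropped): `Var(x :: l) ∈ {Var l, Var l + 1}`; the opposition criterion
`Var(x :: y :: l) = Var(y :: l) + 1 ↔ x y < 0`; **`Var(tail sums of l) ≤ Var(l)`** (`signVar_tailSums_le`, with the invariant that
makes the induction work: at equal counts, opposition to the tail sums' head forces opposition to the list's head); the append /
reversal recursion and **reversal invariance** (`signVar_reverse`); the sequence forms `signVar_tailSums_map_le`
(`k ↦ Σ_{i ∈ [k,m)} g i`) and `signVar_partialSums_map_le` (`k ↦ Σ_{i ≤ k} g i`); and `signVar_prefix_same` (a prefix of entries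
with the strict sign of the next entry does not change `Var`).  These are the two TOTALLY POSITIVE operations behind the LOCAL
DESCARTES RULE of `…LiftingLocalDescartes` (Pólya–Szegő V §1-type facts).  No `def`.
[folklore]
-/

set_option linter.dupNamespace false
set_option autoImplicit false

namespace Summit.ValiantsHypothesis.ValiantsHypothesis.Theorems.KPlusLogSqLaw.LocalDescartes

open Set Finset
open scoped BigOperators
open Literature.Algebra.Polynomial (signVar signVarAux)
open Literature.Computability.AlgebraicComplexity.BD17 (signVar_cons_cons_of_ne_zero)

/-! ## Sign variations: head opposition, tail sums, reversal -/

/-- prepending one entry raises `Var` by at most one and never lowers it. [folklore] -/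
theorem signVar_cons_le_succ (x : ℝ) : ∀ (l : List ℝ), signVar (x :: l) ≤ signVar l + 1 ∧ signVar l ≤ signVar (x :: l)
  | [] => by rw [signVar_single]; simp [signVar, signVarAux]
  | y :: l => by
    by_cases hx : x = 0
    · rw [hx, signVar_zero_cons]; omega
    by_cases hy : y = 0
    · rw [hy, signVar_cons_zero_cons, signVar_zero_cons]; exact signVar_cons_le_succ x l
    · rw [signVar_cons_cons_of_ne_zero hx hy]; split_ifs <;> omega

/-- opposition to a non-zero head: `Var(x :: y :: l) = Var(y :: l) + 1 ↔ x·y < 0`. [folklore] -/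
theorem signVar_cons_eq_succ_iff {y : ℝ} (hy : y ≠ 0) (x : ℝ) (l : List ℝ) :
    signVar (x :: y :: l) = signVar (y :: l) + 1 ↔ x * y < 0 := by
  by_cases hx : x = 0
  · rw [hx, signVar_zero_cons, zero_mul]; simp
  · rw [signVar_cons_cons_of_ne_zero hx hy]
    split_ifs with h
    · simp only [h, iff_true]; omega
    · simp only [h, iff_false]; omega

/-- tail sums of `t :: l`: `(t + Σ l) :: tail sums of l`. [folklore] -/
theorem tailSums_cons (t : ℝ) (l : List ℝ) :
    (List.range (t :: l).length).map (fun j => ((t :: l).drop j).sum)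
      = (t + l.sum) :: (List.range l.length).map (fun j => (l.drop j).sum) := by
  rw [List.length_cons, List.range_succ_eq_map, List.map_cons, List.map_map]
  simp only [List.drop_zero, List.sum_cons, Function.comp_def, List.drop_succ_cons]

/-- the first tail sum is the total sum: opposition to `s + Σl` prepended to the tail sums of `l` forces opposition to `s`,
and then `s + Σ l` has the sign of `s`. [folklore] -/
theorem tailSums_head_aux (l : List ℝ) (s : ℝ)
    (h : signVar ((s + l.sum) :: (List.range l.length).map (fun j => (l.drop j).sum))
      = signVar ((List.range l.length).map (fun j => (l.drop j).sum)) + 1) :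
    signVar (s :: (List.range l.length).map (fun j => (l.drop j).sum))
      = signVar ((List.range l.length).map (fun j => (l.drop j).sum)) + 1 ∧ s ≠ 0 ∧ 0 < s * (s + l.sum) := by
  cases l with
  | nil =>
    simp only [List.length_nil, List.range_zero, List.map_nil, List.sum_nil, add_zero, signVar_single] at h
    have : signVar ([] : List ℝ) = 0 := rfl
    omega
  | cons y l =>
    rw [tailSums_cons] at h ⊢
    simp only [List.sum_cons] at h ⊢
    set T := (List.range l.length).map (fun j => (l.drop j).sum)
    by_cases h0 : y + l.sum = 0
    · rw [h0, add_zero] at h ⊢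
      rw [signVar_zero_cons, signVar_cons_zero_cons] at h ⊢
      have hs : s ≠ 0 := by
        intro hs; rw [hs, signVar_zero_cons] at h; omega
      exact ⟨h, hs, mul_self_pos.mpr hs⟩
    · rw [signVar_cons_eq_succ_iff h0] at h ⊢
      have hs : s * (y + l.sum) < 0 := by nlinarith [mul_self_nonneg (y + l.sum)]
      refine ⟨hs, fun h' => by rw [h', zero_mul] at hs; exact lt_irrefl _ hs, ?_⟩
      nlinarith [mul_self_nonneg (y + l.sum), mul_self_nonneg s]

/-- **`Var` of the tail sums is at most `Var` of the sequence** (with the invariant needed for the induction: when the two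
counts agree, every real opposing the tail sums' leading sign opposes the sequence's leading sign). [folklore] -/
theorem signVar_tailSums_le : ∀ (l : List ℝ),
    signVar ((List.range l.length).map (fun j => (l.drop j).sum)) ≤ signVar l ∧
    (signVar ((List.range l.length).map (fun j => (l.drop j).sum)) = signVar l →
      ∀ x : ℝ, signVar (x :: (List.range l.length).map (fun j => (l.drop j).sum))
          = signVar ((List.range l.length).map (fun j => (l.drop j).sum)) + 1 →
        signVar (x :: l) = signVar l + 1)
  | [] => by simp
  | t :: l => by
    obtain ⟨ih1, ih2⟩ := signVar_tailSums_le l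
    rw [tailSums_cons]
    set T := (List.range l.length).map (fun j => (l.drop j).sum) with hT
    have hT' := signVar_cons_le_succ (t + l.sum) T
    have hl' := signVar_cons_le_succ t l
    -- (1) the inequality
    have step1 : signVar ((t + l.sum) :: T) ≤ signVar (t :: l) := by
      by_cases hopp : signVar ((t + l.sum) :: T) = signVar T + 1
      · obtain ⟨hoppt, _, _⟩ := tailSums_head_aux l t hopp
        by_cases heq : signVar T = signVar l
        · have := ih2 heq t hoppt
          omega
        · have hlt : signVar T < signVar l := lt_of_le_of_ne ih1 heq
          omega
      · omega
    refine ⟨step1, fun heq x hx => ?_⟩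
    -- (2) the invariant
    by_cases ht : t = 0
    · -- `t = 0`: the new head of the tail sums is the old first tail sum
      subst ht
      rw [zero_add] at hx heq
      rw [signVar_zero_cons] at heq
      rw [signVar_cons_zero_cons, signVar_zero_cons]
      -- `Var(Σl :: T) = Var T` and opposition to `Σl :: T` is opposition to `T`
      have hsame : signVar (l.sum :: T) = signVar T ∧
          (signVar (x :: l.sum :: T) = signVar (l.sum :: T) + 1 → signVar (x :: T) = signVar T + 1) := by
        rw [hT]
        cases l with
        | nil =>
          simp only [List.length_nil, List.range_zero, List.map_nil, List.sum_nil, signVar_cons_zero_cons,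
            signVar_single]
          refine ⟨rfl, fun h => ?_⟩
          have : signVar ([] : List ℝ) = 0 := rfl
          omega
        | cons y l =>
          rw [tailSums_cons, List.sum_cons]
          set M := (List.range l.length).map (fun j => (l.drop j).sum)
          by_cases h0 : y + l.sum = 0
          · rw [h0, signVar_zero_cons, signVar_cons_zero_cons]
            exact ⟨rfl, id⟩
          · have e1 : signVar ((y + l.sum) :: (y + l.sum) :: M) = signVar ((y + l.sum) :: M) := by
              rw [signVar_cons_cons_of_ne_zero h0 h0, if_neg (by nlinarith [mul_self_nonneg (y + l.sum)]), zero_add]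
            refine ⟨e1, fun h => ?_⟩
            exact (signVar_cons_eq_succ_iff h0 x M).mpr ((signVar_cons_eq_succ_iff h0 x _).mp h)
      have h2 := hsame.2 hx
      rw [hsame.1] at heq
      exact ih2 heq x h2
    · -- `t ≠ 0`: the new head `t + Σ l` has the sign of `t`
      have hsign : 0 < t * (t + l.sum) := by
        by_cases hopp : signVar ((t + l.sum) :: T) = signVar T + 1
        · exact (tailSums_head_aux l t hopp).2.2
        · -- no opposition on the tail-sum side; equality of counts forces no opposition of `t` to `l` either
          have hle := hT'
          have hVT : signVar ((t + l.sum) :: T) = signVar T := by omega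
          rw [hVT] at heq
          -- `Var T = Var (t :: l) ≥ Var l ≥ Var T` ⇒ `Var T = Var l` and `t` does not oppose `l`
          have hTl : signVar T = signVar l := le_antisymm ih1 (by omega)
          have hnopp : ¬ signVar (t :: l) = signVar l + 1 := by omega
          -- if `t (t + Σl) ≤ 0` then `t` opposes `Σ l = ` first tail sum, hence (invariant) opposes `l`: contradiction
          by_contra hle'
          push Not at hle'
          have hopp2 : signVar (t :: T) = signVar T + 1 := by
            cases l with
            | nil =>
              simp only [List.sum_nil, add_zero] at hle'
              exact absurd hle' (not_le.mpr (mul_self_pos.mpr ht))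
            | cons y l =>
              rw [hT, tailSums_cons]
              simp only [List.sum_cons] at hle'
              have h0 : y + l.sum ≠ 0 := by
                intro h0; rw [h0, add_zero] at hle'; exact absurd hle' (not_le.mpr (mul_self_pos.mpr ht))
              rw [signVar_cons_eq_succ_iff h0]
              nlinarith [mul_self_pos.mpr ht]
          exact hnopp (ih2 hTl t hopp2)
      have ht' : t + l.sum ≠ 0 := fun h => by rw [h, mul_zero] at hsign; exact lt_irrefl _ hsign
      rw [signVar_cons_eq_succ_iff ht'] at hx
      rw [signVar_cons_eq_succ_iff ht]
      by_contra hxt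
      push Not at hxt
      have h1 := mul_neg_of_neg_of_pos hx hsign
      have h2 : x * (t + l.sum) * (t * (t + l.sum)) = (x * t) * ((t + l.sum) * (t + l.sum)) := by ring
      rw [h2] at h1
      exact absurd h1 (not_lt.mpr (mul_nonneg hxt (mul_self_nonneg _)))

/-- `Var` with one entry appended: the recursion from the right (non-zero lists). [folklore] -/
theorem signVarAux_append_pair : ∀ (l : List ℝ) (u x : ℝ),
    signVarAux (l ++ [u, x]) = signVarAux (l ++ [u]) + (if u * x < 0 then 1 else 0)
  | [], u, x => by simp [signVarAux]
  | [v], u, x => by simp [signVarAux]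
  | v :: v' :: l, u, x => by
    have ih := signVarAux_append_pair (v' :: l) u x
    simp only [List.cons_append] at ih ⊢
    simp only [signVarAux]
    rw [ih]
    ring

/-- `Var` is invariant under reversal (non-zero lists). [folklore] -/
theorem signVarAux_reverse : ∀ (l : List ℝ), signVarAux l.reverse = signVarAux l
  | [] => rfl
  | [y] => rfl
  | y :: z :: l => by
    have ih := signVarAux_reverse (z :: l)
    rw [List.reverse_cons, List.reverse_cons, List.append_assoc, List.singleton_append, signVarAux_append_pair,
      ← List.reverse_cons, ih]
    simp only [signVarAux]
    rw [mul_comm z y, add_comm]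

/-- **`Var` is invariant under reversal.** [folklore] -/
theorem signVar_reverse (l : List ℝ) : signVar l.reverse = signVar l := by
  unfold signVar
  rw [List.filter_reverse, signVarAux_reverse]


/-- tail sums of a `List.range`-indexed sequence, as `Finset` sums. [folklore] -/
theorem sum_drop_map_range (g : ℕ → ℝ) : ∀ (m k : ℕ), k ≤ m →
    (((List.range m).map g).drop k).sum = ∑ i ∈ Finset.Ico k m, g i
  | 0, k, hk => by
    have : k = 0 := Nat.le_zero.mp hk
    subst this; simp
  | m + 1, k, hk => by
    rcases Nat.lt_or_eq_of_le hk with hlt | rfl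
    · have hk' : k ≤ m := Nat.lt_succ_iff.mp hlt
      rw [List.range_succ, List.map_append, List.map_singleton,
        List.drop_append_of_le_length (by simpa using hk'), List.sum_append, List.sum_singleton,
        sum_drop_map_range g m k hk', Finset.sum_Ico_succ_top hk']
    · rw [Finset.Ico_self, Finset.sum_empty]
      have : (((List.range (m + 1)).map g).drop (m + 1)) = [] := List.drop_of_length_le (by simp)
      rw [this, List.sum_nil]

/-- **`Var` of tail sums ≤ `Var`**, sequence form. [folklore] -/
theorem signVar_tailSums_map_le (g : ℕ → ℝ) (m : ℕ) :
    signVar ((List.range m).map (fun k => ∑ i ∈ Finset.Ico k m, g i)) ≤ signVar ((List.range m).map g) := by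
  have h := (signVar_tailSums_le ((List.range m).map g)).1
  have hlen : ((List.range m).map g).length = m := by simp
  rw [hlen] at h
  have heq : (List.range m).map (fun k => (((List.range m).map g).drop k).sum)
      = (List.range m).map (fun k => ∑ i ∈ Finset.Ico k m, g i) :=
    List.map_congr_left (fun k hk => sum_drop_map_range g m k (List.mem_range.mp hk).le)
  rw [heq] at h
  exact h

/-- **`Var` of partial sums ≤ `Var`**, sequence form (tail sums of the reversed sequence, `Var` being reversal invariant).
[folklore] -/
theorem signVar_partialSums_map_le (g : ℕ → ℝ) (m : ℕ) :
    signVar ((List.range m).map (fun k => ∑ i ∈ Finset.range (k + 1), g i)) ≤ signVar ((List.range m).map g) := by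
  -- reversed sequence
  have hrev : ∀ (h : ℕ → ℝ), ((List.range m).map h).reverse = (List.range m).map (fun k => h (m - 1 - k)) := by
    intro h
    rw [← List.map_reverse, List.range_eq_range', List.reverse_range', List.map_map, ← List.range_eq_range']
    simp only [zero_add, Function.comp_def]
  have h1 := signVar_tailSums_map_le (fun k => g (m - 1 - k)) m
  -- tail sums of the reversed sequence are the reversed partial sums
  have h2 : (List.range m).map (fun k => ∑ i ∈ Finset.Ico k m, g (m - 1 - i))
      = ((List.range m).map (fun k => ∑ i ∈ Finset.range (k + 1), g i)).reverse := by
    rw [hrev]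
    refine List.map_congr_left (fun k hk => ?_)
    have hkm := List.mem_range.mp hk
    rw [Finset.sum_Ico_eq_sum_range]
    have : m - k = (m - 1 - k) + 1 := by omega
    rw [this, ← Finset.sum_range_reflect]
    refine Finset.sum_congr rfl (fun i hi => ?_)
    have := Finset.mem_range.mp hi
    congr 1; omega
  rw [h2, signVar_reverse] at h1
  rw [← signVar_reverse ((List.range m).map g), hrev]
  exact h1

/-- dropping a prefix whose entries all have the strict sign of the next entry does not change `Var`. [folklore] -/
theorem signVar_prefix_same : ∀ (P : List ℝ) (y : ℝ) (R : List ℝ), (∀ x ∈ P, 0 < x * y) →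
    signVar (P ++ y :: R) = signVar (y :: R)
  | [], _, _, _ => rfl
  | [x], y, R, h => by
    have hxy := h x (by simp)
    have hx : x ≠ 0 := fun hx => by rw [hx, zero_mul] at hxy; exact lt_irrefl _ hxy
    have hy : y ≠ 0 := fun hy => by rw [hy, mul_zero] at hxy; exact lt_irrefl _ hxy
    rw [List.singleton_append, signVar_cons_cons_of_ne_zero hx hy, if_neg (not_lt.mpr hxy.le), zero_add]
  | x :: x' :: P, y, R, h => by
    have hxy := h x (by simp)
    have hx'y := h x' (by simp)
    have hx : x ≠ 0 := fun hx => by rw [hx, zero_mul] at hxy; exact lt_irrefl _ hxy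
    have hx' : x' ≠ 0 := fun hx' => by rw [hx', zero_mul] at hx'y; exact lt_irrefl _ hx'y
    have hxx' : 0 < x * x' := by
      have : 0 < (x * y) * (x' * y) := mul_pos hxy hx'y
      nlinarith [mul_self_nonneg y]
    rw [List.cons_append, List.cons_append, signVar_cons_cons_of_ne_zero hx hx', if_neg (not_lt.mpr hxx'.le), zero_add,
      ← List.cons_append]
    exact signVar_prefix_same (x' :: P) y R (fun z hz => h z (List.mem_cons_of_mem _ hz))


end Summit.ValiantsHypothesis.ValiantsHypothesis.Theorems.KPlusLogSqLaw.LocalDescartes
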